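import Literature.Geometry.Kaehler.ComplexTorusRealMultiplicationLefschetzGroupSymplecticFactors
import Literature.Geometry.Kaehler.ComplexTorusTotallyRealFieldCentralizerLefschetzLieAlgebraDimension
import HarnessLib

/-!
# Milne's Summary table, row «I ∣ Sp_{2g/f} ∣ … `f` copies», for a POLARISED abelian variety with `End⁰(X) = F`
# totally real, and for a SIMPLE one of Albert type I(e): `Lf(X)(ℂ) = S(X)(ℂ) ≃* ∏_{σ : F → ℂ} Sp_{2n}(ℂ)` with
# `n · [F:ℚ] = g` and `#{σ : F → ℂ} = [F:ℚ]`; and `Hg(X)(ℂ) ⊆ ∏_{σ} Sp(V_σ, E_σ)` for any Rosati-fixed field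
# `F ⊆ End⁰(X)` («`Hg(X) ⊆ Lf(X) = Res_{F/ℚ} Sp_F(V, ψ)`»)

Layer `Literature/Geometry/Kaehler`, namespace `Literature.Geometry.Kaehler.ComplexTorus`; lane `lit-hodgefound`
(Track 2 foundations library), Layer A4 (Lefschetz groups); prover seat `lit-hodgefound-p17`, generation 61,
self-proposed row g61-#2 — the polarised ∕ simple front-ends of g61-#1
`ComplexTorusRealMultiplicationLefschetzGroupSymplecticFactors` (the pure-algebra engine: a Darboux eigenframe of
`V_ℂ = ⊕_σ V_σ` for an `E`-symmetric number field `f(K) ⊆ M_ι(ℚ)` and the subgroup identity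
`lefschetzGroupC_eq_conj_pi_symplecticGroupC`, the isomorphism `exists_mulEquiv_pi_symplecticGroupC_lefschetzGroupC`).
Consumed BY NAME: p13's Rosati ∕ CM dictionary (`forall_rosati_algHom_eq_iff_isTotallyReal`,
`exists_rosati_eq_of_range_eq_endAlgRat`, `rosati_eq_iff`: for a polarisation, `f(K) = End⁰(X)` is pointwise
Rosati-fixed iff `K` is totally real), skel-4's `IsRiemannForm.lefschetzIdentityC_eq_lefschetzGroupC_of_rosati_eq_self`
(type I is connected: `Lf = S`), `IsRiemannForm.hodgeGroupC_le_lefschetzGroupC`-type inclusions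
(`hodgeGroupC_le_lefschetzGroupC`), `card_eq_two_mul_finrank` (`#ι = 2g`), the simple-torus centre `centerField` with
`centerField.valAlgHom`, `IsSimple.range_valAlgHom_eq_endAlgRat_of_finrank_eq_one` and the Albert-type vocabulary
`IsAlbertTypeI` (`.isTotallyReal`, `.finrank_eq_one`). THEOREMS ONLY (no definition, no instance, no notation, no
named fact; D-0026, net debt 0).

## Sources, VERBATIM (held text `paper:doi-10-1215-s0012-7094-99-09620-5`, PDF page = printed page − 638)

* J. S. Milne, *Lefschetz classes on abelian varieties*, Duke Math. J. **96** (1999) 639–675, §2 «Simple abelian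
  variety of type I», p. 648–649 (p0010 L37 – p0011 L29): «In this case `E = F`. […] `(V(A), φ) ⊗_k k^al =
  ⊕_{σ:F→k^al} (V_σ, φ_σ)`, `(V_σ, φ_σ) = (V(A), φ) ⊗_{F,σ} k^al` and `S(A)_{k^al} ≅ ∏_{σ:F→k^al} Sp(φ_σ)`»; Summary,
  p. 652 (p0014 L5–L12, L62): «Type ∣ Group ∣ Semisimple ∣ Connected ∣ Dimension ∣ Rank — I ∣ `Sp_{2g/f}` ∣ Yes ∣ Yes ∣
  `2g²/f + g` ∣ `g` […] The group `S(A)_{/k^al}` is isomorphic to `f` copies of the group listed in the second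
  column.»; §4 p. 660: «`L(A) ⊃ Hg(A)`».
* B. Moonen, Yu. Zarhin, *Hodge classes on abelian varieties of low dimension*, Math. Ann. **315** (1999), §2 (2.2)
  ∕ (2.3) (held `paper:arxiv-math_9901113`, p0005): «Type I(2) [I(3)]: `End⁰(X) = F` is a real quadratic [totally real
  cubic] field. There is a unique `F`-symplectic form `ψ : V × V → F` such that `φ = trace_{F/ℚ} ψ`. The Hodge group
  is given by `Hg(X) = Res_{F/ℚ} Sp_F(V,ψ)`» (the inclusion `⊆` holds for every `g` and is what §2 records; equality
  is Ribet's theorem, in the tree for `g/[F:ℚ] = 1` and `g ≤ 3`).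
* H. Lange, *Abelian Varieties over the Complex Numbers* (2023), Thm. 2.6.5 (a) (type I: «`F` is a totally real number
  field and the anti-involution is the identity»), §2.6.1 Proposition (table: type I, `e ∣ g`), §7.2.4 Exercise (4).

## What is proved (`X = E/Φ(ℤ^ι)` polarised by `η` with rational Gram matrix `G`; `f : K →ₐ[ℚ] M_ι(ℚ)`)

* §1 `End⁰(X) = f(K)`, `K` TOTALLY REAL: `IsRiemannForm.forall_rosati_algHom_eq_of_isTotallyReal` (`(f a)' = f a`),
  `IsRiemannForm.forall_transpose_algHom_mul_eq_of_isTotallyReal` (`ᵗ(f a) G = G (f a)`); a Darboux eigenframe with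
  `n · [K:ℚ] = g` in which **`Lf(X)(ℂ) = S(X)(ℂ) = P · e⁻¹(∏_σ Sp_{2n}(ℂ)) · P⁻¹`**
  (`IsRiemannForm.exists_frame_lefschetzGroupC_eq_conj_pi_symplecticGroupC_of_isTotallyReal`); the isomorphisms
  **`IsRiemannForm.nonempty_lefschetzGroupC_mulEquiv_pi_symplecticGroupC_of_isTotallyReal`** and
  **`IsRiemannForm.nonempty_lefschetzIdentityC_mulEquiv_pi_symplecticGroupC_of_isTotallyReal`**
  (`S(X)(ℂ) ≃* ∏_{σ : K →+* ℂ} Sp_{2n}(ℂ) ≃* Lf(X)(ℂ)`, `n · [K:ℚ] = g`, `#(K →+* ℂ) = [K:ℚ]` — «`f` copies of `Sp_{2g/f}`»).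
* §2 `f(K) ⊆ End⁰(X)` pointwise Rosati-fixed (any polarised torus): **`IsRiemannForm.exists_frame_hodgeGroupC_le_conj_pi_symplecticGroupC`**
  (`Hg(X)(ℂ) ⊆ S(X)(ℂ) ⊆ P · e⁻¹(∏_σ Sp_{2n}(ℂ)) · P⁻¹`, `2n · [K:ℚ] = 2g` — «`Hg(X) ⊆ Res_{F/ℚ} Sp_F(V, ψ)`»).
* §3 SIMPLE, ALBERT TYPE I(e) through the centre `F = Z(End⁰(X))` (`[End⁰ : F] = 1`):
  **`IsSimple.nonempty_lefschetzGroupC_mulEquiv_pi_symplecticGroupC_of_isAlbertTypeI`** and the `Lf` form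
  (`S(X)(ℂ) ≃* ∏_{σ : F → ℂ} Sp_{2g/e}(ℂ)`, `n · e = g`).

NOT here: the real points `S(X)(ℝ) ≅ ∏_{σ} Sp_{2n}(ℝ)` (a REAL Darboux eigenframe), types II ∕ III ∕ IV of the «Group» column.
-/

noncomputable section

open Module Matrix NumberField
open Literature.RingTheory.CentralSimple (IsAlbertTypeI)

namespace Literature.Geometry.Kaehler

namespace ComplexTorus

/-! ## §1 Polarised, `End⁰(X) = F` totally real: `Lf(X)(ℂ) = S(X)(ℂ) ≃* ∏_{σ : F → ℂ} Sp_{2g/f}(ℂ)` -/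

section Polarised

variable {ι : Type*} [Fintype ι] [DecidableEq ι] [Nonempty ι] {E : Type*} [NormedAddCommGroup E] [NormedSpace ℂ E]
  {Φ : (ι → ℝ) ≃L[ℝ] E} {η : E [⋀^Fin 2]→L[ℝ] ℝ} {G : Matrix ι ι ℚ} {K : Type*} [Field K] [NumberField K]

/-- **For a polarised torus with `End⁰(X) = f(K)`, `K` totally real, the Rosati involution FIXES `f(K)` POINTWISE**
(`(f a)' = f a`: Lange Thm. 2.6.5 (a), «the anti-involution is the identity»; the tree's
`forall_rosati_algHom_eq_iff_isTotallyReal`). [cite: Lange2023AbelianVarietiesComplex, Thm. 2.6.5 (a)] -/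
theorem IsRiemannForm.forall_rosati_algHom_eq_of_isTotallyReal [IsTotallyReal K] (hη : IsRiemannForm Φ η)
    (hG : G.map (Rat.cast : ℚ → ℝ) = latticeGram Φ η) (f : K →ₐ[ℚ] Matrix ι ι ℚ) (hfE : f.range = endAlgRat Φ)
    (a : K) : rosati G (f a) = f a :=
  (forall_rosati_algHom_eq_iff_isTotallyReal Φ hη.1 hη.2.2 hG f (fun x ↦ hfE ▸ AlgHom.mem_range_self f x)
    (exists_rosati_eq_of_range_eq_endAlgRat Φ hη.1 hη.2.2 hG f hfE)).2 ‹_› a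

/-- `E`-symmetry `ᵗ(f a) G = G (f a)` of a totally real `End⁰(X) = f(K)` (the matrix form of `(f a)' = f a`).
[cite: Lange2023AbelianVarietiesComplex, §2.4.1 (p. 113: `A' = G⁻¹ ᵗA G`) and Thm. 2.6.5 (a)] -/
theorem IsRiemannForm.forall_transpose_algHom_mul_eq_of_isTotallyReal [IsTotallyReal K] (hη : IsRiemannForm Φ η)
    (hG : G.map (Rat.cast : ℚ → ℝ) = latticeGram Φ η) (f : K →ₐ[ℚ] Matrix ι ι ℚ) (hfE : f.range = endAlgRat Φ)
    (a : K) : (f a)ᵀ * G = G * f a :=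
  (rosati_eq_iff (isUnit_det_of_map_ratCast hG hη.isUnit_det_latticeGram) (f a) (f a)).1
    (hη.forall_rosati_algHom_eq_of_isTotallyReal hG f hfE a)

omit [Nonempty ι] in
/-- `End⁰(X) = f(K)` a field is commutative (for the tree's `Lf = S` criterion). [folklore] -/
private theorem endAlgRat_comm_of_range_eq₆₁ (f : K →ₐ[ℚ] Matrix ι ι ℚ) (hfE : f.range = endAlgRat Φ) :
    ∀ a ∈ endAlgRat Φ, ∀ b ∈ endAlgRat Φ, a * b = b * a := by
  intro A hA B hB
  rw [← hfE] at hA hB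
  obtain ⟨a, rfl⟩ := (AlgHom.mem_range f).1 hA
  obtain ⟨b, rfl⟩ := (AlgHom.mem_range f).1 hB
  rw [← map_mul, ← map_mul, mul_comm]

variable [FiniteDimensional ℂ E]

omit [Nonempty ι] [DecidableEq ι] in
include Φ in
/-- `2n · [K:ℚ] = #ι = 2g` reads `n · [K:ℚ] = g`. [cite: Milne1999LefschetzClasses, §2 Summary table (type I: `Sp_{2g/f}`)] -/
private theorem mul_finrank_eq_finrank_of_two_mul₆₁ {n : ℕ} (h : 2 * n * finrank ℚ K = Fintype.card ι) :
    n * finrank ℚ K = finrank ℂ E := by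
  rw [card_eq_two_mul_finrank Φ] at h
  have h' : 2 * (n * finrank ℚ K) = 2 * finrank ℂ E := by rw [← h]; ring
  omega

variable [DecidableEq (K →+* ℂ)] in
/-- **MILNE'S TABLE, TYPE I, THE «GROUP» COLUMN FOR A POLARISED ABELIAN VARIETY WITH `End⁰(X) = F` TOTALLY REAL:
in a Darboux eigenframe `(n, e, P)` of `V_ℂ = ⊕_{σ : F → ℂ} V_σ` with `n · [F:ℚ] = g`,
`Lf(X)(ℂ) = S(X)(ℂ) = P · e⁻¹(∏_{σ : F → ℂ} Sp_{2n}(ℂ)) · P⁻¹`** (the Rosati involution is the identity on `F`, so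
g61-#1 applies; `Lf = S` is the «Connected: Yes» entry of the tree). [cite: Milne1999LefschetzClasses, §2 «Simple abelian variety of type I» (p. 648–649: `S(A)_{k^al} ≅ ∏_{σ:F→k^al} Sp(φ_σ)`) and Summary table (p. 652)]
[cite: Lange2023AbelianVarietiesComplex, Thm. 2.6.5 (a) and §7.2.4 Exercise (4)] -/
theorem IsRiemannForm.exists_frame_lefschetzGroupC_eq_conj_pi_symplecticGroupC_of_isTotallyReal [IsTotallyReal K]
    (hη : IsRiemannForm Φ η) (hG : G.map (Rat.cast : ℚ → ℝ) = latticeGram Φ η) (f : K →ₐ[ℚ] Matrix ι ι ℚ)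
    (hfE : f.range = endAlgRat Φ) :
    ∃ (n : ℕ) (e : ι ≃ Σ _ : (K →+* ℂ), Fin n ⊕ Fin n) (P : Matrix ι ι ℂ) (hP : IsUnit P.det),
      n * finrank ℚ K = finrank ℂ E ∧
      (∀ j : ι, (fun i ↦ P i j) ∈
        ⨅ a : K, Module.End.eigenspace (Matrix.toLin' ((f a).map (algebraMap ℚ ℂ))) ((e j).1 a)) ∧
      Pᵀ * G.map (algebraMap ℚ ℂ) * P = (Matrix.blockDiagonal' fun _ : K →+* ℂ ↦ Matrix.J (Fin n) ℂ).submatrix e e ∧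
      lefschetzGroupC Φ G = (((Subgroup.pi Set.univ fun _ : K →+* ℂ ↦ symplecticGroupC (Fin n)).map
        (sigmaBlockDiagSL (fun _ : K →+* ℂ ↦ Fin n ⊕ Fin n) ℂ)).map (reindexSLC e).symm.toMonoidHom).map
        (conjGLC P hP).toMonoidHom ∧
      lefschetzIdentityC Φ G = (((Subgroup.pi Set.univ fun _ : K →+* ℂ ↦ symplecticGroupC (Fin n)).map
        (sigmaBlockDiagSL (fun _ : K →+* ℂ ↦ Fin n ⊕ Fin n) ℂ)).map (reindexSLC e).symm.toMonoidHom).map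
        (conjGLC P hP).toMonoidHom := by
  obtain ⟨n, e, P, hP, hcard, hcol, hH, hS⟩ := exists_frame_lefschetzGroupC_eq_conj_pi_symplecticGroupC Φ f hfE
    (transpose_eq_neg_of_map_ratCast Φ hG) (isUnit_det_of_map_ratCast hG hη.isUnit_det_latticeGram).ne_zero
    (hη.forall_transpose_algHom_mul_eq_of_isTotallyReal hG f hfE)
  refine ⟨n, e, P, hP, mul_finrank_eq_finrank_of_two_mul₆₁ (Φ := Φ) hcard, hcol, hH, hS, ?_⟩
  rw [← hS]
  exact hη.lefschetzIdentityC_eq_lefschetzGroupC_of_rosati_eq_self hG (endAlgRat_comm_of_range_eq₆₁ f hfE)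
    fun A hA ↦ by
      rw [← hfE] at hA
      obtain ⟨a, rfl⟩ := (AlgHom.mem_range f).1 hA
      exact hη.forall_rosati_algHom_eq_of_isTotallyReal hG f hfE a

/-- **«`S(A)_{/k^al}` IS ISOMORPHIC TO `f` COPIES OF `Sp_{2g/f}`» FOR A POLARISED ABELIAN VARIETY WITH `End⁰(X) = F`
TOTALLY REAL: `S(X)(ℂ) ≃* ∏_{σ : F → ℂ} Sp_{2n}(ℂ)` with `n · [F:ℚ] = g` and `#{σ : F → ℂ} = [F:ℚ]`.**
[cite: Milne1999LefschetzClasses, §2 Summary (p. 652: «I ∣ Sp_{2g/f} … `f` copies») and «Simple abelian variety of type I» (p. 649)]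
[cite: Lange2023AbelianVarietiesComplex, Thm. 2.6.5 (a)] -/
theorem IsRiemannForm.nonempty_lefschetzGroupC_mulEquiv_pi_symplecticGroupC_of_isTotallyReal [IsTotallyReal K]
    (hη : IsRiemannForm Φ η) (hG : G.map (Rat.cast : ℚ → ℝ) = latticeGram Φ η) (f : K →ₐ[ℚ] Matrix ι ι ℚ)
    (hfE : f.range = endAlgRat Φ) :
    ∃ n : ℕ, n * finrank ℚ K = finrank ℂ E ∧ Fintype.card (K →+* ℂ) = finrank ℚ K ∧
      Nonempty (lefschetzGroupC Φ G ≃* ((K →+* ℂ) → symplecticGroupC (Fin n))) := by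
  obtain ⟨n, hcard, hψ⟩ := nonempty_lefschetzGroupC_mulEquiv_pi_symplecticGroupC Φ f hfE
    (transpose_eq_neg_of_map_ratCast Φ hG) (isUnit_det_of_map_ratCast hG hη.isUnit_det_latticeGram).ne_zero
    (hη.forall_transpose_algHom_mul_eq_of_isTotallyReal hG f hfE)
  exact ⟨n, mul_finrank_eq_finrank_of_two_mul₆₁ (Φ := Φ) hcard, Embeddings.card K ℂ, hψ⟩

/-- **LANGE'S `Lf(X)` FOR `End⁰(X) = F` TOTALLY REAL: `Lf(X)(ℂ) ≃* ∏_{σ : F → ℂ} Sp_{2n}(ℂ)`, `n · [F:ℚ] = g`**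
(`Lf(X)(ℂ) = S(X)(ℂ)`, the «Connected: Yes» entry, then §1). [cite: Milne1999LefschetzClasses, §2 Summary (p. 652: «I ∣ Sp_{2g/f} ∣ Yes ∣ Yes»)]
[cite: Lange2023AbelianVarietiesComplex, §7.2.4 Exercise (4) and Thm. 2.6.5 (a)] -/
theorem IsRiemannForm.nonempty_lefschetzIdentityC_mulEquiv_pi_symplecticGroupC_of_isTotallyReal [IsTotallyReal K]
    (hη : IsRiemannForm Φ η) (hG : G.map (Rat.cast : ℚ → ℝ) = latticeGram Φ η) (f : K →ₐ[ℚ] Matrix ι ι ℚ)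
    (hfE : f.range = endAlgRat Φ) :
    ∃ n : ℕ, n * finrank ℚ K = finrank ℂ E ∧ Fintype.card (K →+* ℂ) = finrank ℚ K ∧
      Nonempty (lefschetzIdentityC Φ G ≃* ((K →+* ℂ) → symplecticGroupC (Fin n))) := by
  obtain ⟨n, hn, hc, ⟨ψ⟩⟩ := hη.nonempty_lefschetzGroupC_mulEquiv_pi_symplecticGroupC_of_isTotallyReal hG f hfE
  have hLS : lefschetzIdentityC Φ G = lefschetzGroupC Φ G :=
    hη.lefschetzIdentityC_eq_lefschetzGroupC_of_rosati_eq_self hG (endAlgRat_comm_of_range_eq₆₁ f hfE) fun A hA ↦ by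
      rw [← hfE] at hA
      obtain ⟨a, rfl⟩ := (AlgHom.mem_range f).1 hA
      exact hη.forall_rosati_algHom_eq_of_isTotallyReal hG f hfE a
  exact ⟨n, hn, hc, ⟨(MulEquiv.subgroupCongr hLS).trans ψ⟩⟩

end Polarised

/-! ## §2 A Rosati-fixed field `F ⊆ End⁰(X)`: `Hg(X)(ℂ) ⊆ S(X)(ℂ) ⊆ ∏_{σ : F → ℂ} Sp(V_σ, E_σ)` -/

section Hodge

variable {ι : Type*} [Fintype ι] [DecidableEq ι] {E : Type*} [NormedAddCommGroup E] [NormedSpace ℂ E]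
  {Φ : (ι → ℝ) ≃L[ℝ] E} {η : E [⋀^Fin 2]→L[ℝ] ℝ} {G : Matrix ι ι ℚ} {K : Type*} [Field K] [NumberField K]
  [DecidableEq (K →+* ℂ)]

/-- **«`Hg(X) ⊆ Res_{F/ℚ} Sp_F(V, ψ)`» AT GROUP LEVEL OVER `ℂ`: for a polarised torus `(X, η)` and a number field
`f(K) ⊆ End⁰(X)` POINTWISE FIXED by the Rosati involution of `η`, there is a Darboux eigenframe `(n, e, P)` of
`V_ℂ = ⊕_{σ : K → ℂ} V_σ` (`2n · [K:ℚ] = 2g`) with `Hg(X)(ℂ) ⊆ S(X)(ℂ) ⊆ P · e⁻¹(∏_{σ} Sp_{2n}(ℂ)) · P⁻¹`** — the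
Hodge group acts on every `V_σ` through `Sp(V_σ, E_σ)`. [cite: MoonenZarhin1999LowDim, §2 (2.2)–(2.3) («`Hg(X) = Res_{F/ℚ} Sp_F(V,ψ)`», the inclusion)]
[cite: Milne1999LefschetzClasses, §4 (p. 660: «`L(A) ⊃ Hg(A)`») and §2 «Simple abelian variety of type I»] -/
theorem IsRiemannForm.exists_frame_hodgeGroupC_le_conj_pi_symplecticGroupC (hη : IsRiemannForm Φ η)
    (hG : G.map (Rat.cast : ℚ → ℝ) = latticeGram Φ η) (f : K →ₐ[ℚ] Matrix ι ι ℚ) (hf : ∀ a, f a ∈ endAlgRat Φ)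
    (hRos : ∀ a, rosati G (f a) = f a) :
    ∃ (n : ℕ) (e : ι ≃ Σ _ : (K →+* ℂ), Fin n ⊕ Fin n) (P : Matrix ι ι ℂ) (hP : IsUnit P.det),
      2 * n * finrank ℚ K = Fintype.card ι ∧
      (∀ j : ι, (fun i ↦ P i j) ∈
        ⨅ a : K, Module.End.eigenspace (Matrix.toLin' ((f a).map (algebraMap ℚ ℂ))) ((e j).1 a)) ∧
      Pᵀ * G.map (algebraMap ℚ ℂ) * P = (Matrix.blockDiagonal' fun _ : K →+* ℂ ↦ Matrix.J (Fin n) ℂ).submatrix e e ∧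
      lefschetzGroupC Φ G ≤ (((Subgroup.pi Set.univ fun _ : K →+* ℂ ↦ symplecticGroupC (Fin n)).map
        (sigmaBlockDiagSL (fun _ : K →+* ℂ ↦ Fin n ⊕ Fin n) ℂ)).map (reindexSLC e).symm.toMonoidHom).map
        (conjGLC P hP).toMonoidHom ∧
      hodgeGroupC Φ ≤ (((Subgroup.pi Set.univ fun _ : K →+* ℂ ↦ symplecticGroupC (Fin n)).map
        (sigmaBlockDiagSL (fun _ : K →+* ℂ ↦ Fin n ⊕ Fin n) ℂ)).map (reindexSLC e).symm.toMonoidHom).map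
        (conjGLC P hP).toMonoidHom := by
  have hGu : IsUnit G.det := isUnit_det_of_map_ratCast hG hη.isUnit_det_latticeGram
  have hsym : ∀ a : K, (f a)ᵀ * G = G * f a := fun a ↦ (rosati_eq_iff hGu (f a) (f a)).1 (hRos a)
  obtain ⟨n, e, P, hP, hcard, hcol, hoff, hin⟩ :=
    exists_darbouxEigenframe f (transpose_eq_neg_of_map_ratCast Φ hG) hGu.ne_zero hsym
  have hle := lefschetzGroupC_le_conj_pi_symplecticGroupC Φ f hf hP hcol hoff hin
  exact ⟨n, e, P, hP, hcard, hcol, frameGram_eq_submatrix_blockDiagonal_J hoff hin, hle,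
    (hodgeGroupC_le_lefschetzGroupC Φ (ofRealForm_mem_hodgeClasses_one_of_isRiemannForm Φ hη) hG).trans hle⟩

end Hodge

/-! ## §3 Simple abelian varieties of Albert type I(e): `S(X)(ℂ) ≃* ∏_{σ : F → ℂ} Sp_{2g/e}(ℂ)`, `F = Z(End⁰(X))` -/

section Simple

variable {κ : Type} [Fintype κ] [DecidableEq κ] [Nonempty κ] {E : Type} [NormedAddCommGroup E] [NormedSpace ℂ E]
  [FiniteDimensional ℂ E] {Ψ : (κ → ℝ) ≃L[ℝ] E} {η : E [⋀^Fin 2]→L[ℝ] ℝ} {G : Matrix κ κ ℚ}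

/-- **TYPE I(e) THROUGH THE CENTRE: `S(X)(ℂ) ≃* ∏_{σ : F → ℂ} Sp_{2n}(ℂ)`, `n · e = g`, `#{σ} = e`**, for a SIMPLE
polarised complex torus whose centre `F = Z(End⁰(X))` is totally real with `[End⁰(X) : F] = 1` (then `End⁰(X) = F`).
[cite: Milne1999LefschetzClasses, §2 p. 648 («Simple abelian variety of type I. In this case `E = F`») and Summary table p. 652]
[cite: Lange2023AbelianVarietiesComplex, Thm. 2.6.5 (a) and §2.6.1 Proposition (table, type I: `e ∣ g`)] -/
theorem IsSimple.nonempty_lefschetzGroupC_mulEquiv_pi_symplecticGroupC_of_isTotallyReal_of_finrank_eq_one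
    (hX : IsSimple Ψ) [IsTotallyReal (centerField Ψ hX)] (hη : IsRiemannForm Ψ η)
    (hG : G.map (Rat.cast : ℚ → ℝ) = latticeGram Ψ η) (h1 : finrank (centerField Ψ hX) (endAlgRat Ψ) = 1) :
    ∃ n : ℕ, n * finrank ℚ (centerField Ψ hX) = finrank ℂ E ∧
      Fintype.card (centerField Ψ hX →+* ℂ) = finrank ℚ (centerField Ψ hX) ∧
      Nonempty (lefschetzGroupC Ψ G ≃* ((centerField Ψ hX →+* ℂ) → symplecticGroupC (Fin n))) :=
  hη.nonempty_lefschetzGroupC_mulEquiv_pi_symplecticGroupC_of_isTotallyReal hG (centerField.valAlgHom Ψ hX)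
    (hX.range_valAlgHom_eq_endAlgRat_of_finrank_eq_one h1)

/-- **ALBERT TYPE I: `S(X)(ℂ) ≃* ∏_{σ : F → ℂ} Sp_{2n}(ℂ)` with `n · e = g`, `#{σ : F → ℂ} = e = [F:ℚ]`** — the
Rosati pair `(End⁰(X), ′)` of a simple polarised torus being of Albert type I over its centre `F`
(«I ∣ `Sp_{2g/f}` … `f` copies», Milne's `f` = Lange's `e`). [cite: Milne1999LefschetzClasses, §2 Summary table p. 652 (type I) and p. 649]
[cite: Lange2023AbelianVarietiesComplex, Thm. 2.6.5 (a)] -/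
theorem IsSimple.nonempty_lefschetzGroupC_mulEquiv_pi_symplecticGroupC_of_isAlbertTypeI (hX : IsSimple Ψ)
    (hη : IsRiemannForm Ψ η) (hG : G.map (Rat.cast : ℚ → ℝ) = latticeGram Ψ η)
    (h : IsAlbertTypeI (centerField Ψ hX) (endAlgRat Ψ) (rosatiEnd Ψ hη.1 hη.2.2 hG)) :
    ∃ n : ℕ, n * finrank ℚ (centerField Ψ hX) = finrank ℂ E ∧
      Fintype.card (centerField Ψ hX →+* ℂ) = finrank ℚ (centerField Ψ hX) ∧
      Nonempty (lefschetzGroupC Ψ G ≃* ((centerField Ψ hX →+* ℂ) → symplecticGroupC (Fin n))) := by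
  haveI : IsTotallyReal (centerField Ψ hX) := h.isTotallyReal
  exact hX.nonempty_lefschetzGroupC_mulEquiv_pi_symplecticGroupC_of_isTotallyReal_of_finrank_eq_one hη hG h.finrank_eq_one

/-- **ALBERT TYPE I, LANGE'S `Lf(X)`: `Lf(X)(ℂ) ≃* ∏_{σ : F → ℂ} Sp_{2n}(ℂ)` with `n · e = g`** (type I is connected,
`Lf = S`). [cite: Milne1999LefschetzClasses, §2 Summary table p. 652 («I ∣ Sp_{2g/f} ∣ Yes ∣ Yes»)]
[cite: Lange2023AbelianVarietiesComplex, §7.2.4 Exercise (4) and Thm. 2.6.5 (a)] -/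
theorem IsSimple.nonempty_lefschetzIdentityC_mulEquiv_pi_symplecticGroupC_of_isAlbertTypeI (hX : IsSimple Ψ)
    (hη : IsRiemannForm Ψ η) (hG : G.map (Rat.cast : ℚ → ℝ) = latticeGram Ψ η)
    (h : IsAlbertTypeI (centerField Ψ hX) (endAlgRat Ψ) (rosatiEnd Ψ hη.1 hη.2.2 hG)) :
    ∃ n : ℕ, n * finrank ℚ (centerField Ψ hX) = finrank ℂ E ∧
      Fintype.card (centerField Ψ hX →+* ℂ) = finrank ℚ (centerField Ψ hX) ∧
      Nonempty (lefschetzIdentityC Ψ G ≃* ((centerField Ψ hX →+* ℂ) → symplecticGroupC (Fin n))) := by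
  haveI : IsTotallyReal (centerField Ψ hX) := h.isTotallyReal
  exact hη.nonempty_lefschetzIdentityC_mulEquiv_pi_symplecticGroupC_of_isTotallyReal hG (centerField.valAlgHom Ψ hX)
    (hX.range_valAlgHom_eq_endAlgRat_of_finrank_eq_one h.finrank_eq_one)

end Simple

end ComplexTorus

end Literature.Geometry.Kaehler
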